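import Literature.NumberTheory.GaloisRepresentations.LocalUnramifiedFundamentalClassInvariant
import Literature.NumberTheory.GaloisRepresentations.LocalUnitsFundamentalClass
import Mathlib.Data.Set.Card
import HarnessLib

/-!
# The canonical fundamental class of a finite Galois layer of a local field, in the TREE's
# normalisation: `inv_K ∘ inf : H²(Gal(L/K), Lˣ) ⥲ (1/[L:K])ℤ/ℤ`, `u_{L/K} ↦ 1/[L:K]`
# (Serre, *Local Fields* XIII §3 Prop. 6–7 and Cor., §4; Neukirch, *Bonn Lectures* II §5 (5.5)–(5.6))

Topic `NumberTheory/GaloisRepresentations` (local class field theory); namespace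
`Literature.NumberTheory.GaloisRepresentations.UnitsLayer`.  Proof file: theorems only (no definition,
no named fact, no instance, no notation; D-0026).

For a non-archimedean local field `K : Type` of characteristic `0` and a finite Galois layer
`L ⊆ K̄` (`L : IntermediateField K (AlgebraicClosure K)`), the finite-group engine's units layer
`H²(Gal(L/K), Lˣ) = groupCohomology (Rep.ofAlgebraAutOnUnits K L) 2` inflates injectively into the
tree's Brauer group `H²(K, K̄ˣ) = galoisCohomology (units K) 2` (door-c6 g9, `unitsInfTwo`,
`unitsInfTwo_injective`), on which the tree has THE local invariant map
`Prop121vii.brauerInvariantEquiv K : H²(K, K̄ˣ) ≃+ ℚ/ℤ` (normalised by `inv_n/n` on Kummer images of the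
residue maps `invLevel`).  Writing `inv_{L/K} := brauerInvariantEquiv K ∘ unitsInfTwo K L`, this file proves:

* §1 `mem_range_zmodToQmodZ_of_nsmul_eq_zero`, `range_zmodToQmodZ_eq` — the `n`-torsion of `ℚ/ℤ` is
  `(1/n)ℤ/ℤ = range (zmodToQmodZ n)`.
* §2 **`brauerInvariantEquiv_unitsInfTwo_injective`**, `finrank_nsmul_eq_zero`,
  **`range_brauerInvariantEquiv_unitsInfTwo`**: `inv_{L/K}` is injective with image EXACTLY
  `(1/[L:K])ℤ/ℤ` (Serre XIII §3 Prop. 6 with Cor. 2 to Prop. 7: `H²(L/K) = Br(L/K)` is the subgroup of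
  `Br(K) ≅ ℚ/ℤ` of order `[L:K]`) — from `|H²(Gal(L/K), Lˣ)| = [L:K]` (door-c6 g9
  `natCard_H2_units_eq_finrank_of_isGalois`) and a count; `existsUnique_brauerInvariantEquiv_unitsInfTwo_eq`:
  every `a/[L:K]` is the invariant of exactly one class.
* §3 **THE CANONICAL FUNDAMENTAL CLASS**: `existsUnique_fundamentalClass` — there is exactly one
  `u_{L/K} ∈ H²(Gal(L/K), Lˣ)` with `inv_{L/K}(u_{L/K}) = 1/[L:K]` (Serre XIII §4 "the element
  `u_{L/K} ∈ H²(L/K)` with `inv(u_{L/K}) = 1/n`"); `addOrderOf_eq_of_brauerInvariantEquiv_unitsInfTwo_eq`;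
  the DICTIONARY with the engine's class modules (`Literature.Algebra.Homology.IsClassModule`, Lang III §3 /
  Neukirch I §7 (7.3)): **`isClassModule_iff_isUnit`** — a 2-cocycle `φ` with `inv_{L/K}[φ] = a/[L:K]` is a
  fundamental class in the engine's sense iff `a` is a unit of `ℤ/[L:K]`; hence
  **`exists_isClassModule_inv_eq`** (a cocycle `φ` with `IsClassModule (Rep.ofAlgebraAutOnUnits K L) φ` AND
  `inv_{L/K}[φ] = 1/[L:K]` — the canonical class is a class-module generator),
  `IsClassModule.exists_isUnit_inv_eq` (every engine fundamental class has invariant `a/[L:K]`, `a` a unit)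
  and `IsClassModule.H2π_eq_of_inv_eq` (two engine fundamental classes with the same invariant coincide).
* §4 `brauerInvariantEquiv_unitsInfTwo_neg_frobeniusCocycle` — for the unramified layer `K_m/K` the
  canonical class is MINUS the engine's Frobenius class: `inv_{K_m/K}(−[c_σ · π_K]) = 1/m` for the
  arithmetic Frobenius `σ` (door-c6 g9 `brauerInvariantEquiv_unitsInfTwo_frobeniusCocycle`: `= −1/m` for
  `[c_σ · π_K]`), i.e. `u_{K_m/K} = [c_{σ⁻¹}·π_K]`-normalisation of Serre XIII §4.

What this gives the Poitou–Tate assembly of the bsd-schneider cell (crux `AnticycControlAdditiveK`, Route A):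
at every place and every finite layer, a fundamental class of the engine (hence Tate–Nakayama
`Ĥⁿ(U, M) ≅ Ĥⁿ⁺²(U, Lˣ ⊗ M)`, `tateNakayamaIso`, and the norm residue isomorphism) whose image in
`galoisCohomology` has THE invariant `1/[L:K]` of `LocalInvariants.canonical` / `brauerInvariantEquiv` —
the local input of the global invariant `inv = Σ_v inv_v` on idèle classes.  Not here: the restriction
formula `inv_{L/E}(res u_{L/K}) = u_{L/E}` across the two algebraic closures `K̄`, `Ē` (only its
consequence `res_U u_{L/K}` generates `H²(U, Lˣ)`, inside `IsClassModule`), and inflation `L ⊆ L'`.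
HONEST FRAMING: classical local class field theory; no case of BSD or of Poitou–Tate is proved here.

## References
* J.-P. Serre, *Local Fields*, GTM 67 (1979), Ch. XIII §3 Prop. 6, Prop. 7 and Cor. 1–3, §4 (the
  fundamental class `u_{L/K}`, Thm. 1). [SerreLocalFields1979]
* J. Neukirch, *Class Field Theory — The Bonn Lectures* (2013), Part II §5 Def. (5.5), Thm. (5.6);
  Part I §7 Thm. (7.3). [Neukirch2013]
* S. Lang, *Topics in Cohomology of Groups*, LNM 1625 (1996), Ch. III §3 (class modules), Ch. IX §1.
  [Lang1996]
-/

noncomputable section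

open CategoryTheory groupCohomology Field Function

namespace Literature.NumberTheory.GaloisRepresentations

namespace UnitsLayer

open Literature.Algebra.Homology
open Literature.AnabelianGeometry.AbsoluteAnabelian.Prop121vii

/-! ## §1. The `n`-torsion of `ℚ/ℤ` is `(1/n)ℤ/ℤ` -/

section QmodZ

/-- An `n`-torsion element of `ℚ/ℤ` lies in `(1/n)ℤ/ℤ = range (ℤ/n → ℚ/ℤ, k ↦ k/n)`.
[cite: SerreLocalFields1979, Ch. XIII §3 Cor. 2 to Prop. 7] -/
theorem mem_range_zmodToQmodZ_of_nsmul_eq_zero (n : ℕ) [NeZero n] (t : AddCircle (1 : ℚ))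
    (ht : n • t = 0) : t ∈ Set.range (zmodToQmodZ n) := by
  haveI : Fact (0 < (1 : ℚ)) := ⟨one_pos⟩
  obtain ⟨m, hm, hmt⟩ := (AddCircle.nsmul_eq_zero_iff (NeZero.pos n)).1 ht
  refine ⟨(m : ZMod n), ?_⟩
  rw [zmodToQmodZ_apply, ZMod.val_cast_of_lt hm, ← hmt, mul_one]

/-- `n • (k/n) = 0` in `ℚ/ℤ`. [cite: SerreLocalFields1979, Ch. XIII §3 Cor. 2 to Prop. 7] -/
theorem nsmul_zmodToQmodZ (n : ℕ) [NeZero n] (a : ZMod n) : n • zmodToQmodZ n a = 0 := by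
  rw [← map_nsmul, nsmul_eq_mul, ZMod.natCast_self, zero_mul, map_zero]

/-- The `n`-torsion of `ℚ/ℤ` is exactly `(1/n)ℤ/ℤ`. [cite: SerreLocalFields1979, Ch. XIII §3 Cor. 2 to Prop. 7] -/
theorem range_zmodToQmodZ_eq (n : ℕ) [NeZero n] :
    Set.range (zmodToQmodZ n) = {t : AddCircle (1 : ℚ) | n • t = 0} := by
  ext t
  constructor
  · rintro ⟨a, rfl⟩
    exact nsmul_zmodToQmodZ n a
  · exact fun ht => mem_range_zmodToQmodZ_of_nsmul_eq_zero n t ht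

/-- `zmodToQmodZ n` preserves additive orders (it is injective).
[cite: SerreLocalFields1979, Ch. XIII §3 Cor. 2 to Prop. 7] -/
theorem addOrderOf_zmodToQmodZ (n : ℕ) [NeZero n] (a : ZMod n) :
    addOrderOf (zmodToQmodZ n a) = addOrderOf a :=
  addOrderOf_injective (zmodToQmodZ n) (zmodToQmodZ_injective n) a

/-- In `ℤ/n` (`n ≠ 0`): `a` has additive order `n` iff `a` is a unit.
[cite: SerreLocalFields1979, Ch. XIII §4 Thm. 1] -/
theorem _root_.ZMod.addOrderOf_eq_iff_isUnit {n : ℕ} [NeZero n] (a : ZMod n) :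
    addOrderOf a = n ↔ IsUnit a := by
  have hn : n ≠ 0 := NeZero.ne n
  conv_lhs => rw [← ZMod.natCast_zmod_val a, ZMod.addOrderOf_coe a.val hn]
  rw [← ZMod.natCast_zmod_val a, ZMod.isUnit_iff_coprime, ZMod.natCast_zmod_val]
  constructor
  · intro h
    have hg : n.gcd a.val = 1 := by
      rcases Nat.div_eq_self.1 h with h0 | h1
      · exact absurd h0 hn
      · exact h1
    rw [Nat.Coprime, Nat.gcd_comm]
    exact hg
  · intro h
    rw [Nat.Coprime, Nat.gcd_comm] at h
    rw [h, Nat.div_one]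

end QmodZ

/-! ## §2. `inv_{L/K} = inv_K ∘ inf : H²(Gal(L/K), Lˣ) ↪ ℚ/ℤ` is injective with image `(1/[L:K])ℤ/ℤ` -/

section Layer

variable (K : Type) [Field K] [ValuativeRel K] [TopologicalSpace K] [IsNonarchimedeanLocalField K]
  [CharZero K]
variable (L : IntermediateField K (AlgebraicClosure K)) [FiniteDimensional K L] [IsGalois K L]

/-- **`inv_{L/K} = inv_K ∘ inf` is injective** on `H²(Gal(L/K), Lˣ)` (`unitsInfTwo` is injective, door-c6 g9;
`inv_K` is an isomorphism). [cite: SerreLocalFields1979, Ch. XIII §3 Prop. 6] -/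
theorem brauerInvariantEquiv_unitsInfTwo_injective :
    Injective fun x : groupCohomology (Rep.ofAlgebraAutOnUnits K L) 2 =>
      brauerInvariantEquiv K (unitsInfTwo K L x) :=
  (brauerInvariantEquiv K).injective.comp (unitsInfTwo_injective K L)

omit [CharZero K] in
/-- `[L:K] · x = 0` for every `x ∈ H²(Gal(L/K), Lˣ)` (a group of order `[L:K]`).
[cite: SerreLocalFields1979, Ch. XIII §3 Prop. 6] -/
theorem finrank_nsmul_eq_zero (x : groupCohomology (Rep.ofAlgebraAutOnUnits K L) 2) :
    Module.finrank K L • x = 0 := by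
  have h := addOrderOf_dvd_natCard x
  rw [natCard_H2_units_eq_finrank_of_isGalois K L] at h
  exact addOrderOf_dvd_iff_nsmul_eq_zero.1 h

/-- `[L:K] · inv_{L/K}(x) = 0` in `ℚ/ℤ`. [cite: SerreLocalFields1979, Ch. XIII §3 Prop. 6] -/
theorem finrank_nsmul_brauerInvariantEquiv_unitsInfTwo (x : groupCohomology (Rep.ofAlgebraAutOnUnits K L) 2) :
    Module.finrank K L • brauerInvariantEquiv K (unitsInfTwo K L x) = 0 := by
  rw [← map_nsmul, ← map_nsmul, finrank_nsmul_eq_zero K L x, map_zero, map_zero]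

variable {n : ℕ} [NeZero n]

/-- Every invariant `inv_{L/K}(x)` is of the form `a/[L:K]`.
[cite: SerreLocalFields1979, Ch. XIII §3 Cor. 2 to Prop. 7] -/
theorem exists_brauerInvariantEquiv_unitsInfTwo_eq_zmodToQmodZ (hn : Module.finrank K L = n)
    (x : groupCohomology (Rep.ofAlgebraAutOnUnits K L) 2) :
    ∃ a : ZMod n, brauerInvariantEquiv K (unitsInfTwo K L x) = zmodToQmodZ n a := by
  obtain ⟨a, ha⟩ := mem_range_zmodToQmodZ_of_nsmul_eq_zero n _
    (by rw [← hn]; exact finrank_nsmul_brauerInvariantEquiv_unitsInfTwo K L x)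
  exact ⟨a, ha.symm⟩

/-- **`inv_{L/K}(H²(Gal(L/K), Lˣ)) = (1/[L:K])ℤ/ℤ`**: the image of `H²(L/K) = Br(L/K)` in `Br(K) ≅ ℚ/ℤ` is
EXACTLY the subgroup of order `[L:K]` (Serre XIII §3 Prop. 6: `H²(L/K)` has order `[L:K]`; Cor. 2 to
Prop. 7: it is the `[L:K]`-torsion of `ℚ/ℤ`).  Proof: `⊆` by `[L:K] · x = 0`; equality by counting, `inv_{L/K}`
being injective on a group of order `[L:K]` (`natCard_H2_units_eq_finrank_of_isGalois`).
[cite: SerreLocalFields1979, Ch. XIII §3 Prop. 6 and Cor. 2 to Prop. 7] -/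
theorem range_brauerInvariantEquiv_unitsInfTwo (hn : Module.finrank K L = n) :
    Set.range (fun x : groupCohomology (Rep.ofAlgebraAutOnUnits K L) 2 =>
      brauerInvariantEquiv K (unitsInfTwo K L x)) = Set.range (zmodToQmodZ n) := by
  classical
  have hsub : Set.range (fun x : groupCohomology (Rep.ofAlgebraAutOnUnits K L) 2 =>
      brauerInvariantEquiv K (unitsInfTwo K L x)) ⊆ Set.range (zmodToQmodZ n) := by
    rintro t ⟨x, rfl⟩
    obtain ⟨a, ha⟩ := exists_brauerInvariantEquiv_unitsInfTwo_eq_zmodToQmodZ K L hn x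
    exact ⟨a, ha.symm⟩
  haveI : Finite (groupCohomology (Rep.ofAlgebraAutOnUnits K L) 2) :=
    Nat.finite_of_card_ne_zero (by
      rw [natCard_H2_units_eq_finrank_of_isGalois K L, hn]; exact NeZero.ne n)
  refine Set.eq_of_subset_of_ncard_le hsub ?_ (Set.toFinite _)
  rw [Set.ncard_range_of_injective (zmodToQmodZ_injective n),
    Set.ncard_range_of_injective (brauerInvariantEquiv_unitsInfTwo_injective K L), Nat.card_zmod,
    natCard_H2_units_eq_finrank_of_isGalois K L, hn]

/-- **Every `a/[L:K] ∈ ℚ/ℤ` is the invariant of exactly one class of `H²(Gal(L/K), Lˣ)`**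
(`inv_{L/K} : H²(L/K) ⥲ (1/[L:K])ℤ/ℤ`). [cite: SerreLocalFields1979, Ch. XIII §3 Prop. 6 and Cor. 2 to Prop. 7] -/
theorem existsUnique_brauerInvariantEquiv_unitsInfTwo_eq (hn : Module.finrank K L = n) (a : ZMod n) :
    ∃! x : groupCohomology (Rep.ofAlgebraAutOnUnits K L) 2,
      brauerInvariantEquiv K (unitsInfTwo K L x) = zmodToQmodZ n a := by
  have hmem : zmodToQmodZ n a ∈ Set.range (fun x : groupCohomology (Rep.ofAlgebraAutOnUnits K L) 2 =>
      brauerInvariantEquiv K (unitsInfTwo K L x)) := by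
    rw [range_brauerInvariantEquiv_unitsInfTwo K L hn]
    exact ⟨a, rfl⟩
  obtain ⟨x, hx⟩ := hmem
  exact ⟨x, hx, fun y hy => brauerInvariantEquiv_unitsInfTwo_injective K L (hy.trans hx.symm)⟩

/-- The additive order of a class equals that of its invariant numerator: if `inv_{L/K}(x) = a/[L:K]` then
`ord(x) = ord(a)` in `ℤ/[L:K]`. [cite: SerreLocalFields1979, Ch. XIII §3 Prop. 6] -/
theorem addOrderOf_eq_of_brauerInvariantEquiv_unitsInfTwo_eq
    {x : groupCohomology (Rep.ofAlgebraAutOnUnits K L) 2} {a : ZMod n}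
    (hx : brauerInvariantEquiv K (unitsInfTwo K L x) = zmodToQmodZ n a) : addOrderOf x = addOrderOf a := by
  rw [← addOrderOf_zmodToQmodZ n a, ← hx]
  exact (addOrderOf_injective ((brauerInvariantEquiv K).toAddMonoidHom.comp (unitsInfTwo K L))
    (brauerInvariantEquiv_unitsInfTwo_injective K L) x).symm

/-! ## §3. The canonical fundamental class `u_{L/K}` and the engine's class modules -/

/-- **THE CANONICAL FUNDAMENTAL CLASS** (Serre XIII §4: "`u_{L/K} ∈ H²(L/K)`, `inv(u_{L/K}) = 1/n`";
Neukirch II (5.5)): there is exactly one class `u_{L/K} ∈ H²(Gal(L/K), Lˣ)` whose image in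
`H²(K, K̄ˣ) = Br(K)` has invariant `1/[L:K]` for THE invariant map `brauerInvariantEquiv` of the tree.
[cite: SerreLocalFields1979, Ch. XIII §4 (definition of `u_{L/K}`)][cite: Neukirch2013, Part II §5 Def. (5.5)] -/
theorem existsUnique_fundamentalClass (hn : Module.finrank K L = n) :
    ∃! u : groupCohomology (Rep.ofAlgebraAutOnUnits K L) 2,
      brauerInvariantEquiv K (unitsInfTwo K L u) = zmodToQmodZ n 1 :=
  existsUnique_brauerInvariantEquiv_unitsInfTwo_eq K L hn 1

/-- **Dictionary engine ↔ tree: a 2-cocycle `φ` of `Lˣ` with `inv_{L/K}[φ] = a/[L:K]` is a fundamental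
class of the CLASS MODULE `(Gal(L/K), Lˣ)` in the engine's sense (`IsClassModule`, Lang III §3 /
Neukirch I (7.3)) iff `a` is a unit of `ℤ/[L:K]`** — i.e. iff `[φ]` generates `H²(L/K)`; axiom I
(Hilbert 90 on every `L/L^U`) and `|H²(U, Lˣ)| = |U|` hold for every layer of a local field (door-c6 g9).
[cite: SerreLocalFields1979, Ch. XIII §4 Thm. 1][cite: Neukirch2013, Part I §7 Thm. (7.3) Addendum] -/
theorem isClassModule_iff_isUnit (hn : Module.finrank K L = n)
    (φ : cocycles₂ (Rep.ofAlgebraAutOnUnits K L)) {a : ZMod n}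
    (hφ : brauerInvariantEquiv K (unitsInfTwo K L (H2π (Rep.ofAlgebraAutOnUnits K L) φ)) = zmodToQmodZ n a) :
    IsClassModule (Rep.ofAlgebraAutOnUnits K L) φ ↔ IsUnit a := by
  rw [isClassModule_iff_card, ← ZMod.addOrderOf_eq_iff_isUnit,
    ← addOrderOf_eq_of_brauerInvariantEquiv_unitsInfTwo_eq K L hφ, IsGalois.card_aut_eq_finrank, hn]
  exact ⟨fun h => h.2.2, fun h => ⟨isZero_H1_res_units K L, natCard_H2_res_units_of_isGalois K L, h⟩⟩

/-- **The canonical fundamental class is a class-module generator**: there is a 2-cocycle `φ` of `Lˣ`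
with `IsClassModule (Rep.ofAlgebraAutOnUnits K L) φ` AND `inv_{L/K}[φ] = 1/[L:K]` — for EVERY finite Galois
layer of a characteristic-`0` non-archimedean local field.  This is the engine's local class formation
(Tate's theorem `Ĥⁿ(U, ℤ) ≅ Ĥⁿ⁺²(U, Lˣ)`, Tate–Nakayama with coefficients, the norm residue isomorphism)
on the generator normalised by THE invariant map of the tree.
[cite: SerreLocalFields1979, Ch. XIII §4 Thm. 1][cite: Neukirch2013, Part II §5 Thm. (5.6)] -/
theorem exists_isClassModule_inv_eq (hn : Module.finrank K L = n) :
    ∃ φ : cocycles₂ (Rep.ofAlgebraAutOnUnits K L), IsClassModule (Rep.ofAlgebraAutOnUnits K L) φ ∧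
      brauerInvariantEquiv K (unitsInfTwo K L (H2π (Rep.ofAlgebraAutOnUnits K L) φ)) = zmodToQmodZ n 1 := by
  obtain ⟨u, hu, -⟩ := existsUnique_fundamentalClass K L hn
  obtain ⟨φ, rfl⟩ : ∃ φ : cocycles₂ (Rep.ofAlgebraAutOnUnits K L),
      H2π (Rep.ofAlgebraAutOnUnits K L) φ = u := by
    induction u using H2_induction_on with
    | h φ => exact ⟨φ, rfl⟩
  exact ⟨φ, (isClassModule_iff_isUnit K L hn φ hu).2 isUnit_one, hu⟩

/-- **Every fundamental class of the engine has a unit invariant**: if `IsClassModule (Lˣ) φ` then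
`inv_{L/K}[φ] = a/[L:K]` for a unit `a` of `ℤ/[L:K]` (the generators of `H²(L/K) ≅ (1/n)ℤ/ℤ`).
[cite: SerreLocalFields1979, Ch. XIII §4 Thm. 1][cite: Lang1996, Ch. III §3] -/
theorem IsClassModule.exists_isUnit_inv_eq (hn : Module.finrank K L = n)
    {φ : cocycles₂ (Rep.ofAlgebraAutOnUnits K L)} (hA : IsClassModule (Rep.ofAlgebraAutOnUnits K L) φ) :
    ∃ a : ZMod n, IsUnit a ∧
      brauerInvariantEquiv K (unitsInfTwo K L (H2π (Rep.ofAlgebraAutOnUnits K L) φ)) = zmodToQmodZ n a := by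
  obtain ⟨a, ha⟩ := exists_brauerInvariantEquiv_unitsInfTwo_eq_zmodToQmodZ K L hn
    (H2π (Rep.ofAlgebraAutOnUnits K L) φ)
  exact ⟨a, (isClassModule_iff_isUnit K L hn φ ha).1 hA, ha⟩

omit [NeZero n] in
/-- **Rigidity**: two 2-cocycles of `Lˣ` with the same invariant have the same class; in particular the
canonical fundamental class is unique among the engine's fundamental classes.
[cite: SerreLocalFields1979, Ch. XIII §3 Prop. 6] -/
theorem H2π_eq_of_brauerInvariantEquiv_unitsInfTwo_eq {φ ψ : cocycles₂ (Rep.ofAlgebraAutOnUnits K L)}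
    (h : brauerInvariantEquiv K (unitsInfTwo K L (H2π (Rep.ofAlgebraAutOnUnits K L) φ)) =
      brauerInvariantEquiv K (unitsInfTwo K L (H2π (Rep.ofAlgebraAutOnUnits K L) ψ))) :
    H2π (Rep.ofAlgebraAutOnUnits K L) φ = H2π (Rep.ofAlgebraAutOnUnits K L) ψ :=
  brauerInvariantEquiv_unitsInfTwo_injective K L h

/-- **Every class is an integer multiple of the canonical class**, the multiplier being read off the
invariant: if `inv_{L/K}(u) = 1/[L:K]` and `inv_{L/K}(x) = a/[L:K]` then `x = a · u` (for any lift of `a`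
to `ℤ`). [cite: SerreLocalFields1979, Ch. XIII §3 Prop. 6 and §4] -/
theorem eq_zsmul_of_brauerInvariantEquiv_unitsInfTwo_eq
    {u x : groupCohomology (Rep.ofAlgebraAutOnUnits K L) 2}
    (hu : brauerInvariantEquiv K (unitsInfTwo K L u) = zmodToQmodZ n 1) (k : ℤ)
    (hx : brauerInvariantEquiv K (unitsInfTwo K L x) = zmodToQmodZ n (k : ZMod n)) : x = k • u := by
  apply brauerInvariantEquiv_unitsInfTwo_injective K L
  change brauerInvariantEquiv K (unitsInfTwo K L x) = brauerInvariantEquiv K (unitsInfTwo K L (k • u))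
  rw [map_zsmul, map_zsmul, hu, hx, ← map_zsmul, zsmul_eq_mul, mul_one]

end Layer

/-! ## §4. The unramified layers: `u_{K_m/K} = −[c_σ · π_K]` for the arithmetic Frobenius `σ` -/

section Unramified

open LocalWeilDatum IsNonarchimedeanLocalField ValuativeRel
open scoped Valued

variable (K : Type) [Field K] [ValuativeRel K] [TopologicalSpace K] [IsNonarchimedeanLocalField K]
  [CharZero K]

/-- **The canonical fundamental class of the unramified layer `K_m/K` is MINUS the engine's Frobenius
class**: `inv_{K_m/K}(−[c_σ · π_K]) = (1 % |G|)/|G| = 1/m` for the arithmetic Frobenius `σ = φ|_{K_m}`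
(`IsFrobPow φ 1`) generating `G = Gal(K_m/K)` and a uniformiser `π_K` — the class of the carry cocycle of
`σ⁻¹` on `π_K`; door-c6 g9's `brauerInvariantEquiv_unitsInfTwo_frobeniusCocycle` gives `−(1 % |G|)/|G|`
for `[c_σ · π_K]` itself (the engine's own `inv_σ` being `+1/m`).  So the engine's unramified class module
with generator `σ⁻¹` is the tree's canonical one (Serre XIII §4: `u_{K_n/K}` is the image of the class of
the Frobenius under `δ : H¹(G, ℚ/ℤ) ≅ H²(G, ℤ)` cupped with `π`, in the tree's sign convention).
[cite: SerreLocalFields1979, Ch. XIII §4 (the class `u_{L/K}` for `L` unramified)][cite: Neukirch2013, Part II §4 Def. (4.5)] -/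
theorem brauerInvariantEquiv_unitsInfTwo_neg_frobeniusCocycle {m : ℕ} (hm : 0 < m)
    [IsGalois K (unramifiedLevel K m)]
    (σ : unramifiedLevel K m ≃ₐ[K] unramifiedLevel K m) (hσ : ∀ x, x ∈ Subgroup.zpowers σ)
    {φ : absoluteGaloisGroup K} (hφ : IsFrobPow φ 1) (hσφ : resGal (unramifiedLevel K m) φ = σ)
    (π : 𝒪[K]) (hπ : Irreducible π)
    (hϖ : ∀ g : unramifiedLevel K m ≃ₐ[K] unramifiedLevel K m,
      (Rep.ofAlgebraAutOnUnits K (unramifiedLevel K m)).ρ g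
        (Additive.ofMul (Units.mk0 (algebraMap K (unramifiedLevel K m) (π : K))
          ((map_ne_zero _).2 fun h => hπ.ne_zero (Subtype.ext h)))) =
        Additive.ofMul (Units.mk0 (algebraMap K (unramifiedLevel K m) (π : K))
          ((map_ne_zero _).2 fun h => hπ.ne_zero (Subtype.ext h)))) :
    haveI := finiteDimensional_unramifiedLevel K hm
    haveI : NeZero (Fintype.card (unramifiedLevel K m ≃ₐ[K] unramifiedLevel K m)) :=
      ⟨Fintype.card_ne_zero⟩
    brauerInvariantEquiv K (unitsInfTwo K (unramifiedLevel K m)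
      (-H2π _ (Unramified.frobeniusCocycle σ hσ (Rep.ofAlgebraAutOnUnits K (unramifiedLevel K m)) _ hϖ))) =
      zmodToQmodZ (Fintype.card (unramifiedLevel K m ≃ₐ[K] unramifiedLevel K m)) 1 := by
  haveI := finiteDimensional_unramifiedLevel K hm
  haveI : NeZero (Fintype.card (unramifiedLevel K m ≃ₐ[K] unramifiedLevel K m)) := ⟨Fintype.card_ne_zero⟩
  rw [map_neg, map_neg, brauerInvariantEquiv_unitsInfTwo_frobeniusCocycle K hm σ hσ hφ hσφ π hπ hϖ, neg_neg,
    zmodToQmodZ_apply, ZMod.val_one_eq_one_mod]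

omit [CharZero K] in
/-- The degree of the unramified level equals the order of its Galois group: the `n` of §2–§3 for `K_m/K`
may be taken to be `Fintype.card Gal(K_m/K) = m`. [cite: SerreLocalFields1979, Ch. XIII §4] -/
theorem fintypeCard_gal_unramifiedLevel {m : ℕ} (hm : 0 < m) :
    haveI := finiteDimensional_unramifiedLevel K hm
    Fintype.card (unramifiedLevel K m ≃ₐ[K] unramifiedLevel K m) = m := by
  haveI := finiteDimensional_unramifiedLevel K hm
  haveI := isGalois_unramifiedLevel K hm
  rw [Fintype.card_eq_nat_card, IsGalois.card_aut_eq_finrank, finrank_unramifiedLevel K hm]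

/-- **For the unramified layer, MINUS the engine's Frobenius class IS the canonical fundamental class**
(the unique class with invariant `1/m`): combine §3 uniqueness with the computation above.
[cite: SerreLocalFields1979, Ch. XIII §4][cite: Neukirch2013, Part II §4 Def. (4.5)] -/
theorem eq_neg_frobeniusCocycle_of_inv_eq {m : ℕ} (hm : 0 < m)
    [IsGalois K (unramifiedLevel K m)]
    (σ : unramifiedLevel K m ≃ₐ[K] unramifiedLevel K m) (hσ : ∀ x, x ∈ Subgroup.zpowers σ)
    {φ : absoluteGaloisGroup K} (hφ : IsFrobPow φ 1) (hσφ : resGal (unramifiedLevel K m) φ = σ)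
    (π : 𝒪[K]) (hπ : Irreducible π)
    (hϖ : ∀ g : unramifiedLevel K m ≃ₐ[K] unramifiedLevel K m,
      (Rep.ofAlgebraAutOnUnits K (unramifiedLevel K m)).ρ g
        (Additive.ofMul (Units.mk0 (algebraMap K (unramifiedLevel K m) (π : K))
          ((map_ne_zero _).2 fun h => hπ.ne_zero (Subtype.ext h)))) =
        Additive.ofMul (Units.mk0 (algebraMap K (unramifiedLevel K m) (π : K))
          ((map_ne_zero _).2 fun h => hπ.ne_zero (Subtype.ext h))))
    [NeZero m] {u : haveI := finiteDimensional_unramifiedLevel K hm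
      groupCohomology (Rep.ofAlgebraAutOnUnits K (unramifiedLevel K m)) 2}
    (hu : haveI := finiteDimensional_unramifiedLevel K hm
      brauerInvariantEquiv K (unitsInfTwo K (unramifiedLevel K m) u) = zmodToQmodZ m 1) :
    haveI := finiteDimensional_unramifiedLevel K hm
    u = -H2π _ (Unramified.frobeniusCocycle σ hσ (Rep.ofAlgebraAutOnUnits K (unramifiedLevel K m)) _ hϖ) := by
  haveI := finiteDimensional_unramifiedLevel K hm
  haveI : NeZero (Fintype.card (unramifiedLevel K m ≃ₐ[K] unramifiedLevel K m)) := ⟨Fintype.card_ne_zero⟩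
  apply brauerInvariantEquiv_unitsInfTwo_injective K (unramifiedLevel K m)
  change brauerInvariantEquiv K (unitsInfTwo K (unramifiedLevel K m) u) =
    brauerInvariantEquiv K (unitsInfTwo K (unramifiedLevel K m) (-H2π _ _))
  rw [hu, brauerInvariantEquiv_unitsInfTwo_neg_frobeniusCocycle K hm σ hσ hφ hσφ π hπ hϖ,
    zmodToQmodZ_apply, zmodToQmodZ_apply, ZMod.val_one_eq_one_mod, ZMod.val_one_eq_one_mod,
    fintypeCard_gal_unramifiedLevel K hm]

end Unramified

end UnitsLayer

end Literature.NumberTheory.GaloisRepresentations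

end
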